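import Summits.QuantumFields.BalabanUV.Beta.CombOneShotJets

/-!
# `BalabanUV.Beta.CombOneShotJetsTabs` — binder row D1 (OWNER an2), RULING R-D1-g42-4 ∕ TID § F.10 (L3′): **THE ONE-SHOT COMPOSITE JET DATA OVER A SCALE-INDEXED
# TABLE RECORD — `JcOfTabs hLc N tabs cΛ cB m : JetData 3 (Lc^m)` := the (III′) family's LEVEL-0 member AT BLOCKING `Lc^m` OVER `tabs m`** — with `JcOf` (p339189) as
# the instance `tabs m := symTablesAn1S2 3 (Lc^m) (cΛ m)` (`rfl`) and the depth-0 naming `hbase` transported along `Lc¹ = Lc`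

WHY.  RULING R-D1-g42-4 (journal l.46750; CONFIRMED by Engine C's exact detector R-FP-22-DET1, `ttrl/balaban-calc/qcomp/QCOMP.md`, RELAY 210: at `(d+1, Lc) = (4, 3)`,
depth 1, the one-shot AVERAGING tables at `N = 9` and the composite jets of two `Lc = 3` stages DIFFER as tables — every bond, every entry; the Wilson tables agree
by identity): the ONE `Jc : ∀ m, JetData 3 (Lc^m)` shared by road «FP»'s `htel` and road «BF-x»'s `hrep` in ROOT M‴ is the COMPOSITE-CONTOUR literal
`JcComp m := JsB12CombShSym (Lc := Lc^m) hLc.pow N (tabsComp m) (cΛ m) (cB m) 0` over a scale-indexed record `tabsComp : ∀ m, SymTables 3 (Lc^m)` whose `Q`∕`Λ`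
members are the composite-contour tables (to be supplied; their order-1 torus face is d1-formalise-leaf-02's `compIns₁`), with `tabsComp 1 =` an1's one-step
record so that an4's `hbase` carries over.  This file NAMES the generic object (a `def`, asserting nothing): `JcOf` is its an1-instance by `rfl`, and `hbase` is
proved for ANY `tabs` whose scale-1 member is (heterogeneously) a given `SymTables 3 Lc`.

WHAT.
* §1 **`JcOfTabs hLc N tabs cΛ cB : ∀ m, JetData 3 (Lc^m)`** := `fun m ↦ JsB12CombShSym (Lc := Lc^m) hLc.pow N (tabs m) (cΛ m) (cB m) 0`; `JcOfTabs_apply` (`rfl`);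
  **`JcOf_eq_JcOfTabs`**: `JcOf hLc N cΛ cB = JcOfTabs hLc N (fun m ↦ symTablesAn1S2 3 (Lc^m) (cΛ m)) cΛ cB` (`rfl`).
* §2 `TOf_JsB12CombShSym_congr_heq` (transport of the one-shot kernel of the level-0 member along an equality of blockings AND a heterogeneous equality of
  table records) and **`TshotOf_JcOfTabs_one`**: for `tabs₁ : SymTables 3 Lc` with `HEq (tabs 1) tabs₁`,
  `TshotOf Lc (JcOfTabs hLc N tabs cΛ cB) 1 = TbalOf Lc (JsB12CombShSym hLc N tabs₁ (cΛ 1) (cB 1)) 0` — an4's `hbase` binder at the generic literal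
  (`KInvStep Lc 0 = KInv`, `vertexOfK KInv Lc = vertexOf`, exactly as `CombOneShotJets.TshotOf_JcOf_one`); `symTables_heq_of_eq` (the `HEq` letter for
  scale-indexed records built uniformly in the blocking) and the re-derivation `TshotOf_JcOf_one'` through the generic lemma.
WHAT THIS IS NOT: not `tabsComp` (the composite-contour `Q`∕`Λ` tables are NOT typed here — the row names the SLOT, the suppliers fill it); not a claim that any
`tabs` IS Bałaban's composite record; nothing of Bałaban's asserted; `D1Tel` ∕ `D1Rep` OPEN; NOT (T-ID), NOT D1, NEVER «G-an2-4 closed», NOT BetaPertH,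
NOT continuum, NOT Clay.

HONEST DEPENDENCY (page 1, mandatory): continuum YM on T⁴ ⇐ BetaPertH ∧ nine spine estimates (0/9 proved); BetaPertH ⇐ (D1) ∧ (D4) ∧ CAP+tail;
G-an2-4 gates asym, D1 and NE2/3/4.  HONEST FRAMING (cell contract, verbatim): «discharging `BetaPertH` makes Bałaban's UV stability UNCONDITIONAL —
a real constructive-QFT result; it is NOT the continuum limit and NOT the Clay problem.»  ABSOLUTE RULE (cell charter, verbatim): «No internally-minted
statement may enter as a cited fact. Every hypothesis is either kernel-proved in this package or a verbatim quotation of a PUBLISHED theorem with page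
reference. The manuscript(s) under audit are NOT citable for their own disputed steps — they are the thing under adjudication; programme-internal
(2001/route/tribunal) claims are never citable.»  [our object] one `def` (a NAME over a displayed table-record SLOT) + [folklore] five lemmas; nothing cited,
no `def … : Prop`, 0 sorry.  Row D1 OWNER an2 (b2b-balaban-beta-an2) gen 43, 2026-08-22.  No existing file touched.
-/

noncomputable section

namespace Summit.QuantumFields.BalabanUV.Beta.CombOneShotJetsTabs

open Literature.MathematicalPhysics.QuantumFieldTheory.Balaban1983to89
open Literature.MathematicalPhysics.QuantumFieldTheory.Balaban1983to89.Beta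
open OneStepResolventKernel (JetData TOf)
open OneStepKernelFamily (TshotOf TbalOf TstepOf vertexOfK vertexOfK_KInv)
open Summit.QuantumFields.BalabanUV.Beta.BorderedHessian (KInvStep_zero_eq)
open Summit.QuantumFields.BalabanUV.Beta.SymmetrisedStepJets (SymTables)
open Summit.QuantumFields.BalabanUV.Beta.SymSecondOrderTablesAn1 (symTablesAn1S2)
open Summit.QuantumFields.BalabanUV.Beta.CombChartJointEnd (JsB12CombShSym)
open Summit.QuantumFields.BalabanUV.Beta.CombOneShotJets (JcOf JcOf_apply)

variable {Lc : ℕ} [NeZero Lc]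

/-! ## §1 The one-shot composite jet data over a scale-indexed table record -/

/-- [our object — a NAME over a displayed table-record SLOT, asserting nothing] **THE ONE-SHOT COMPOSITE JET DATA OVER `tabs`** at scale `m`: the level-`0`
member of the chart-(III′) literal `JsB12CombShSym` AT BLOCKING `Lc^m` over the scale-`m` record `tabs m : SymTables 3 (Lc^m)` (pins `(cE, cVH, cE₂) =
((Lc^m)⁴, −(Lc^m)⁸∕2, (Lc^m)⁸)` built in; lock numerals `cΛ cB : ℕ → ℝ` free functions of the scale). -/
def JcOfTabs (hLc : Odd Lc) (N : ℕ) (tabs : ∀ m : ℕ, SymTables 3 (Lc ^ m)) (cΛ cB : ℕ → ℝ) : ∀ m : ℕ, JetData 3 (Lc ^ m) := fun m =>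
  JsB12CombShSym (Lc := Lc ^ m) (hLc.pow) N (tabs m) (cΛ m) (cB m) 0

/-- [folklore] `JcOfTabs` unfolded (`rfl`). -/
theorem JcOfTabs_apply (hLc : Odd Lc) (N : ℕ) (tabs : ∀ m : ℕ, SymTables 3 (Lc ^ m)) (cΛ cB : ℕ → ℝ) (m : ℕ) :
    JcOfTabs hLc N tabs cΛ cB m = JsB12CombShSym (Lc := Lc ^ m) (hLc.pow) N (tabs m) (cΛ m) (cB m) 0 := rfl

/-- [folklore] **`JcOf` IS THE an1-RECORD INSTANCE of `JcOfTabs`** (`tabs m := symTablesAn1S2 3 (Lc^m) (cΛ m)`; `rfl`). -/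
theorem JcOf_eq_JcOfTabs (hLc : Odd Lc) (N : ℕ) (cΛ cB : ℕ → ℝ) :
    JcOf hLc N cΛ cB = JcOfTabs hLc N (fun m => symTablesAn1S2 3 (Lc ^ m) (cΛ m)) cΛ cB := rfl

/-! ## §2 The depth-0 naming `hbase` at the generic literal -/

/-- [folklore] transport of the one-shot kernel of the level-0 member along an equality of blockings `n = Lc` and a heterogeneous equality of the table
records (`subst`; both sides are lattice kernels on `ℤ⁴`). -/
theorem TOf_JsB12CombShSym_congr_heq {n : ℕ} [NeZero n] (hn : Odd n) (hLc : Odd Lc) (h : n = Lc) (N : ℕ) {t' : SymTables 3 n} {t : SymTables 3 Lc}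
    (ht : HEq t' t) (c b : ℝ) :
    TOf (N := n) (JsB12CombShSym (Lc := n) hn N t' c b 0) = TOf (N := Lc) (JsB12CombShSym hLc N t c b 0) := by
  subst h
  cases ht
  rfl

/-- [folklore] the `HEq` letter for scale-indexed records built UNIFORMLY in the blocking: `F n = F m` heterogeneously whenever `n = m`
(the instance arguments are propositions). -/
theorem symTables_heq_of_eq {d n m : ℕ} [NeZero n] [NeZero m] (h : n = m) (F : ∀ k : ℕ, NeZero k → SymTables d k) :
    HEq (F n inferInstance) (F m inferInstance) := by
  subst h
  rfl

/-- [folklore] **`hbase` AT THE GENERIC LITERAL — THE ONE-SHOT KERNEL AT DEPTH 1 IS THE ONE-STEP KERNEL AT LEVEL 0**: for any scale-indexed record whose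
scale-1 member is (heterogeneously) `tabs₁ : SymTables 3 Lc`,
`TshotOf Lc (JcOfTabs hLc N tabs cΛ cB) 1 = TbalOf Lc (JsB12CombShSym hLc N tabs₁ (cΛ 1) (cB 1)) 0`
(`Lc¹ = Lc` by transport, `KInvStep Lc 0 = KInv`, `vertexOfK KInv Lc = vertexOf` — as `CombOneShotJets.TshotOf_JcOf_one`). -/
theorem TshotOf_JcOfTabs_one (hLc : Odd Lc) (N : ℕ) (tabs : ∀ m : ℕ, SymTables 3 (Lc ^ m)) (cΛ cB : ℕ → ℝ) (tabs₁ : SymTables 3 Lc)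
    (h1 : HEq (tabs 1) tabs₁) :
    TshotOf Lc (JcOfTabs hLc N tabs cΛ cB) 1 = TbalOf Lc (JsB12CombShSym hLc N tabs₁ (cΛ 1) (cB 1)) 0 := by
  show TOf (N := Lc ^ 1) (JcOfTabs hLc N tabs cΛ cB 1) = TstepOf Lc 0 _
  rw [JcOfTabs_apply, TOf_JsB12CombShSym_congr_heq (hLc.pow) hLc (pow_one Lc) N h1]
  unfold TOf TstepOf
  rw [KInvStep_zero_eq, show vertexOfK (OneStepResolventKernel.KInv (N := Lc)) Lc (JsB12CombShSym hLc N tabs₁ (cΛ 1) (cB 1) 0).S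
    = OneStepResolventKernel.vertexOf (N := Lc) (JsB12CombShSym hLc N tabs₁ (cΛ 1) (cB 1) 0).S from
    funext fun μ => funext fun y => vertexOfK_KInv _ μ y]

/-- [folklore] re-derivation of `CombOneShotJets.TshotOf_JcOf_one` THROUGH the generic lemma (the `HEq` letter is `symTables_heq_of_eq (pow_one Lc)`):
`TshotOf Lc (JcOf hLc N cΛ cB) 1 = TbalOf Lc (JsB12CombShSym hLc N (symTablesAn1S2 3 Lc (cΛ 1)) (cΛ 1) (cB 1)) 0`. -/
theorem TshotOf_JcOf_one' (hLc : Odd Lc) (N : ℕ) (cΛ cB : ℕ → ℝ) :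
    TshotOf Lc (JcOf hLc N cΛ cB) 1 = TbalOf Lc (JsB12CombShSym hLc N (symTablesAn1S2 3 Lc (cΛ 1)) (cΛ 1) (cB 1)) 0 := by
  rw [JcOf_eq_JcOfTabs]
  exact TshotOf_JcOfTabs_one hLc N _ cΛ cB _ (symTables_heq_of_eq (pow_one Lc) fun k _ => symTablesAn1S2 3 k (cΛ 1))

end Summit.QuantumFields.BalabanUV.Beta.CombOneShotJetsTabs

end
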